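import Literature.Probability.RandomPlanarGeometry.SelfAvoidingWalk
import Literature.Probability.RandomPlanarGeometry.ChordalCurveFamily
import Literature.Probability.LatticeModels.MeshDomainJordan
import Literature.Probability.Percolation.CLE6
import HarnessLib

/-!
# The scaling limit of the critical planar SAW as a chordal curve family

Topic `Literature/Probability/RandomPlanarGeometry` (definition item `defn-SAW.IsScalingLimitFamily`,
for crux `stmt-CriticalPhenomena-1371` of route SAWRestrictionRigidity; the same clause is the
`(lim)` hypothesis of the cruxes `ConfCovLimit`, `RestrictionOfLimit`, `SimpleOfLimit` of route
SAWConfRestriction). It bridges `SelfAvoidingWalk.lean` (the critical `δℤ²` SAW laws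
`SAW.law`, endpoint approximations `SAW.IsEndpointApprox`, the conjunct `SAW.SAWScalingLimit`)
and `ChordalCurveFamily.lean` (`ChordalFamily`, `ChordalFamily.IsChordal`), neither of which
imports the other.

## Contents (namespace `Literature.Probability.RandomPlanarGeometry`, sub-namespace `SAW`)

* `SAW.IsScalingLimitFamily P` — **`P` is the (full) scaling limit of the critical square-lattice
  SAW as a chordal curve family**: `P` is chordal (probability laws on curves in `D̄` from `a` to
  `b`) and, for EVERY Dobrushin domain `D = (Ω; a, b)` and EVERY endpoint approximation
  `a_δ, b_δ` (`SAW.IsEndpointApprox`), the critical SAW law `P_δ ∝ μ^{-|γ|}` on SAWs of `Ω_δ` from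
  `a_δ` to `b_δ`, pushed to curves modulo reparametrisation, converges weakly along `δ → 0⁺`
  (`TendstoLaw`, bounded continuous test functions) to `P D`. This is Lawler–Schramm–Werner's
  conjecture "the measures … converge weakly to a measure `m_SAW(z, w; D)`" (LSW 2004, §3.4.2,
  boundary-to-boundary case, normalised as `m^#_SAW(z, w; D)` in §4.1) made a PROPERTY of a
  candidate family `P`; the value of `P` is not identified here (LSW, §1: "we do not know how to
  prove the existence of the limit"). The body is literally the clause `∃`-quantified in
  `LimitExists` of route SAWRestrictionRigidity, so `LimitExists ↔ ∃ P, SAW.IsScalingLimitFamily P`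
  holds by `Iff.rfl`.
* `SAW.exists_isEndpointApprox` — **every Dobrushin domain admits an endpoint approximation**
  (proved): the `∀ a b, IsEndpointApprox D a b → …` clause is never vacuous. Uses the tree's
  theorem that the largest mesh component of a Jordan domain is the bulk
  (`JordanDomain.exists_forall_mem_meshDomain_and_reachable`, `MeshDomainJordan.lean`) through a
  diagonal stage selection `exists_stage_tendsto_atTop` along `δ → 0⁺`.
* Uniqueness (proved): weak limits along the proper filter `𝓝[>] 0` are unique among finite
  Borel measures (`TendstoLaw.unique`, `Percolation/CLE6.lean`), hence `IsScalingLimitFamily P → IsScalingLimitFamily P'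
  → P = P'` (`SAW.IsScalingLimitFamily.unique`), and `P D` depends on `D` only through
  `(D.carrier, D.pt 0, D.pt 1)` (`SAW.IsScalingLimitFamily.apply_eq`,
  `….apply_eq_of_carrier_eq`) — the boundary parametrisation carried by a `DobrushinDomain` is
  invisible to the lattice model.
* Reformulation of the conjunct (proved): a scaling-limit family all of whose laws are chordal
  SLE_{8/3} laws gives `SAW.SAWScalingLimit` (`SAW.IsScalingLimitFamily.sawScalingLimit`, the
  two-line `integral_map` argument of the route assemblies, no further hypothesis); conversely,
  under `SAW.SAWScalingLimit` and uniqueness in law of chordal SLE (`IsSLECurve.map_eq`), every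
  chordal family of SLE_{8/3} laws is a scaling-limit family
  (`SAW.isScalingLimitFamily_of_sawScalingLimit`), whence
  `SAWScalingLimit ↔ ∃ P, IsScalingLimitFamily P ∧ ∀ D, IsSLELaw (8/3) D (P D)` as soon as one
  chordal SLE_{8/3} family is given (`SAW.sawScalingLimit_iff_of_chordal_sle`; the tree's
  `sleEightThirdsFamily` with `sleEightThirdsFamily_spec`, `ConformalRestrictionProofs.lean`,
  is such a family under the facts listed there — not imported here to keep this file light).

## Design notes

* Convergence is `TendstoLaw … id (P D)`: the limit variable is the identity of `CurveClass ℂ`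
  under the law `P D`, exactly as in the route files; no measurability or probability
  hypotheses are built into `TendstoLaw`, the probability normalisation comes from `IsChordal`.
* `IsChordal` is part of the bundle (as in `LimitExists`): the weak limit of probability laws
  carried by polylines of `Ω̄_δ` from `δ a_δ → a` to `δ b_δ → b` is expected to be a probability
  law on curves in `D̄` from `a` to `b`, but tightness/portmanteau are not available at this
  level, so the property is recorded, not derived.
* Junk conventions inherited from `SAW.law` (the zero measure when `a_δ`, `b_δ` are not joined)
  are immaterial: `IsEndpointApprox.reachable` excludes them for all small `δ`.

## References

* G. F. Lawler, O. Schramm, W. Werner, *On the scaling limit of planar self-avoiding walk*,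
  Proc. Sympos. Pure Math. 72, Part 2 (2004), 339–364, arXiv:math/0204277: §3.4.1 (weak
  convergence of measures on curves modulo parametrisation), §3.4.2 (scaling limits for SAWs,
  boundary-to-boundary measure `m_SAW(z, w; D)`), §4.1 (`m^#_SAW(z, w; D)`; Prediction: chordal
  SLE_{8/3}), §1 ("we do not know how to prove the existence of the limit").
* H. Duminil-Copin, S. Smirnov, *The connective constant of the honeycomb lattice equals
  `√(2+√2)`*, Ann. of Math. 175 (2012), §4, Conjecture 1.
* P. Billingsley, *Convergence of probability measures*, 2nd ed. (1999), Thm 1.2 (a finite Borel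
  measure on a metric space is determined by the integrals of bounded continuous functions).
* S. Smirnov, C. R. Acad. Sci. Paris 333 (2001), §2 (largest-component discretisation).

## Mathlib / tree

Mathlib: `MeasureTheory.integral_map`, `Nat.findGreatest`, `Metric.mem_closure_iff`,
`Filter.eventually_all_finset`. Tree: `TendstoLaw.unique` (Percolation/CLE6: weak limits of finite
Borel measures along `𝓝[>] 0` are unique, via `ext_of_forall_integral_eq_of_IsFiniteMeasure`),
`SAW.law / DomainSAW.curve / IsEndpointApprox / SAWScalingLimit / aemeasurable_curve`
(SelfAvoidingWalk), `ChordalFamily.IsChordal` (ChordalCurveFamily), `TendstoLaw` (CurveSpace),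
`IsSLELaw`, `IsSLECurve.map_eq` (SLE), `nearestSite`, `dist_meshPoint_nearestSite_le`,
`meshDomain`, `discreteDomainGraph_adj_iff` (DomainDiscretisation),
`JordanDomain.exists_forall_mem_meshDomain_and_reachable` (MeshDomainJordan). Mathlib has no SAW,
SLE or lattice-discretisation notions (searched `selfAvoiding`, `ScalingLimit`, `meshDomain`).
-/

noncomputable section

open MeasureTheory Filter Topology Set Metric
open Literature.Probability.LatticeModels
open scoped NNReal ENNReal

namespace Literature.Probability.RandomPlanarGeometry

namespace SAW

/-! ### The definition -/

/-- **`P` is the scaling limit of the critical square-lattice SAW, as a chordal curve family.**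
The chordal family `P : DobrushinDomain → Measure (CurveClass ℂ)` is chordal (each `P D` is a
probability law carried by curves in `D̄` from `a = D.pt 0` to `b = D.pt 1`) and, for every
Dobrushin domain `D = (Ω; a, b)` and every endpoint approximation `a_δ, b_δ` of `a, b` in
`Ω_δ ⊆ δℤ²` (`IsEndpointApprox`), the critical SAW law `P_δ(γ) ∝ μ^{-|γ|}` on self-avoiding
walks of `Ω_δ` from `a_δ` to `b_δ` (`law`), pushed to curves modulo reparametrisation
(`DomainSAW.curve`), converges weakly as `δ → 0⁺` to `P D` (`TendstoLaw … id (P D)`: for every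
bounded continuous `f`, `∫ f(γ.curve) dP_δ → ∫ f d(P D)`). Lawler–Schramm–Werner conjecture that
"the measures … converge weakly to a measure `m_SAW(z, w; D)`" on curves joining two boundary
points, normalised to the probability measure `m^#_SAW(z, w; D)` (§3.4.2, §4.1), and
Duminil-Copin–Smirnov (Conjecture 1) that "the law of `γ_δ` in `(Ω_δ, a_δ, b_δ)` converges when
`δ → 0`"; here the existence of the limit is made a property of the candidate family `P`, whose
value is NOT identified (the conjunct `SAWScalingLimit` says it is chordal SLE_{8/3}; see
`IsScalingLimitFamily.sawScalingLimit`, `sawScalingLimit_iff_of_chordal_sle`). Literally the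
clause of `LimitExists` / `AxiomsOfLimit` (route SAWRestrictionRigidity) and the `(lim)` clause
of route SAWConfRestriction. [cite: LawlerSchrammWerner2004SAW, §3.4.2 and §4.1] -/
def IsScalingLimitFamily (P : ChordalFamily) : Prop :=
  P.IsChordal ∧ ∀ (D : DobrushinDomain) (a b : ℝ → Site 2), IsEndpointApprox D a b →
    TendstoLaw (fun δ (γ : DomainSAW D.carrier δ (a δ) (b δ)) => γ.curve)
      (fun δ => law D.carrier δ (a δ) (b δ)) id (P D)

variable {P P' : ChordalFamily}

/-- Unfolding `IsScalingLimitFamily` (the form inlined in the route files). [folklore] -/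
theorem isScalingLimitFamily_iff :
    IsScalingLimitFamily P ↔ P.IsChordal ∧
      ∀ (D : DobrushinDomain) (a b : ℝ → Site 2), IsEndpointApprox D a b →
        TendstoLaw (fun δ (γ : DomainSAW D.carrier δ (a δ) (b δ)) => γ.curve)
          (fun δ => law D.carrier δ (a δ) (b δ)) id (P D) :=
  Iff.rfl

/-- A scaling-limit family is chordal. [folklore] -/
theorem IsScalingLimitFamily.isChordal (hP : IsScalingLimitFamily P) : P.IsChordal := hP.1

/-- The convergence clause of a scaling-limit family. [cite: LawlerSchrammWerner2004SAW, §3.4.2] -/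
theorem IsScalingLimitFamily.tendstoLaw (hP : IsScalingLimitFamily P) {D : DobrushinDomain}
    {a b : ℝ → Site 2} (hab : IsEndpointApprox D a b) :
    TendstoLaw (fun δ (γ : DomainSAW D.carrier δ (a δ) (b δ)) => γ.curve)
      (fun δ => law D.carrier δ (a δ) (b δ)) id (P D) :=
  hP.2 D a b hab

/-- Each law of a scaling-limit family is a probability measure. [folklore] -/
theorem IsScalingLimitFamily.isProbabilityMeasure (hP : IsScalingLimitFamily P)
    (D : DobrushinDomain) : IsProbabilityMeasure (P D) :=
  (hP.1 D).1

end SAW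

/-! ### Mesh paths inside the discrete domain `Ω_δ` -/

/-- `Ω_δ = meshDomain Ω δ` is a union of connected components of the mesh graph on mesh
vertices: a mesh vertex adjacent to a vertex of `Ω_δ` belongs to `Ω_δ`. [folklore] -/
theorem mem_meshDomain_of_adj {Ω : Set ℂ} {δ : ℝ} {u w : meshVertices Ω δ}
    (hu : (u : Site 2) ∈ meshDomain Ω δ) (h : (meshVertexGraph Ω δ).Adj u w) :
    (w : Site 2) ∈ meshDomain Ω δ := by
  simp only [meshDomain, mem_iUnion, mem_image] at hu ⊢
  obtain ⟨C, hC, u', hu'C, hu'u⟩ := hu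
  refine ⟨C, hC, w, ?_, rfl⟩
  have huu' : u' = u := Subtype.ext hu'u
  subst huu'
  rw [SimpleGraph.ConnectedComponent.mem_supp_iff] at hu'C ⊢
  rw [← hu'C]
  exact SimpleGraph.ConnectedComponent.sound h.symm.reachable

/-- A walk of the mesh graph on mesh vertices that starts in `Ω_δ` is a walk of the graph
`Ω_δ = discreteDomainGraph Ω δ` (all its vertices lie in `Ω_δ`). [folklore] -/
theorem reachable_discreteDomainGraph_of_walk {Ω : Set ℂ} {δ : ℝ} {u w : meshVertices Ω δ}
    (p : (meshVertexGraph Ω δ).Walk u w) (hu : (u : Site 2) ∈ meshDomain Ω δ) :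
    (discreteDomainGraph Ω δ).Reachable u w := by
  induction p with
  | nil => rfl
  | @cons u v w hadj p ih =>
    have hv : (v : Site 2) ∈ meshDomain Ω δ := mem_meshDomain_of_adj hu hadj
    have hadj' : (meshGraph Ω δ).Adj u v := by
      simpa only [SimpleGraph.comap_adj, Function.Embedding.subtype_apply] using hadj
    exact (discreteDomainGraph_adj_iff.2 ⟨hadj', hu, hv⟩).reachable.trans (ih hv)

/-! ### Diagonal stage selection along `δ → 0⁺` -/

/-- **Diagonal extraction along `δ → 0⁺`.** If stage `n` of a sequence of properties holds at
every mesh `δ ∈ (0, ε n)` (`ε n > 0`), there is a stage selector `N : ℝ → ℕ` such that, as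
`δ → 0⁺`, eventually the property of stage `N δ` holds at `δ`, and `N δ → ∞`. (Take `N δ` the
largest `n ≤ ⌈δ⁻¹⌉` with `δ < min (ε k) (1/(k+1))` for all `k ≤ n`.) [folklore] -/
theorem exists_stage_tendsto_atTop {p : ℕ → ℝ → Prop} {ε : ℕ → ℝ} (hε : ∀ n, 0 < ε n)
    (hp : ∀ n δ, 0 < δ → δ < ε n → p n δ) :
    ∃ N : ℝ → ℕ, (∀ᶠ δ in 𝓝[>] (0 : ℝ), p (N δ) δ) ∧ Tendsto N (𝓝[>] (0 : ℝ)) atTop := by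
  classical
  set ε' : ℕ → ℝ := fun n => min (ε n) (1 / ((n : ℝ) + 1)) with hε'_def
  have hε' : ∀ n, 0 < ε' n := fun n => lt_min (hε n) (by positivity)
  set Q : ℝ → ℕ → Prop := fun δ n => ∀ k ≤ n, δ < ε' k with hQ_def
  have hbound : ∀ {δ : ℝ} {n : ℕ}, 0 < δ → Q δ n → n ≤ ⌈δ⁻¹⌉₊ := by
    intro δ n hδ hQ
    have h1 : δ < 1 / ((n : ℝ) + 1) := (hQ n le_rfl).trans_le (min_le_right _ _)
    have h2 : (n : ℝ) + 1 < δ⁻¹ := by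
      rw [lt_inv_comm₀ (by positivity) hδ, ← one_div]
      exact h1
    exact (Nat.lt_ceil.2 (by linarith)).le
  refine ⟨fun δ => Nat.findGreatest (Q δ) ⌈δ⁻¹⌉₊, ?_, ?_⟩
  · filter_upwards [Ioo_mem_nhdsGT (hε' 0)] with δ hδ
    have hQ0 : Q δ 0 := fun k hk => by
      rw [Nat.le_zero.1 hk]
      exact hδ.2
    have hQN : Q δ (Nat.findGreatest (Q δ) ⌈δ⁻¹⌉₊) :=
      Nat.findGreatest_spec (Nat.zero_le _) hQ0
    exact hp _ δ hδ.1 ((hQN _ le_rfl).trans_le (min_le_left _ _))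
  · rw [Filter.tendsto_atTop]
    intro n
    have hQ : ∀ᶠ δ in 𝓝[>] (0 : ℝ), ∀ k ∈ Finset.range (n + 1), δ < ε' k :=
      (eventually_all_finset _).2 fun k _ =>
        mem_nhdsWithin_of_mem_nhds (Iio_mem_nhds (hε' k))
    filter_upwards [hQ, self_mem_nhdsWithin] with δ hQn hδ
    have hQn' : Q δ n := fun k hk => hQn k (Finset.mem_range_succ_iff.2 hk)
    exact Nat.le_findGreatest (hbound hδ hQn') hQn'

/-- If `N δ → ∞` as `δ → 0⁺` and `z n → p` at rate `1/(n+1)`, then the mesh points of the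
lattice sites nearest to `z (N δ)` converge to `p` as `δ → 0⁺` (they are within `δ` of
`z (N δ)`, `dist_meshPoint_nearestSite_le`). [folklore] -/
theorem tendsto_meshPoint_nearestSite_of_tendsto {z : ℕ → ℂ} {p : ℂ} {N : ℝ → ℕ}
    (hz : ∀ n, dist (z n) p < 1 / ((n : ℝ) + 1)) (hN : Tendsto N (𝓝[>] (0 : ℝ)) atTop) :
    Tendsto (fun δ => meshPoint δ (nearestSite δ (z (N δ)))) (𝓝[>] (0 : ℝ)) (𝓝 p) := by
  rw [Metric.tendsto_nhds]
  intro ε hε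
  obtain ⟨n₀, hn₀⟩ := exists_nat_one_div_lt (half_pos hε)
  filter_upwards [Ioo_mem_nhdsGT (half_pos hε), hN.eventually (eventually_ge_atTop n₀)]
    with δ hδ hNδ
  have h1 : dist (meshPoint δ (nearestSite δ (z (N δ)))) (z (N δ)) ≤ δ :=
    dist_meshPoint_nearestSite_le hδ.1 _
  have h2 : dist (z (N δ)) p < ε / 2 := by
    refine (hz (N δ)).trans_le ((one_div_le_one_div_of_le (by positivity) ?_).trans hn₀.le)
    have : (n₀ : ℝ) ≤ N δ := by exact_mod_cast hNδ
    linarith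
  calc dist (meshPoint δ (nearestSite δ (z (N δ)))) p
      ≤ dist (meshPoint δ (nearestSite δ (z (N δ)))) (z (N δ)) + dist (z (N δ)) p :=
        dist_triangle _ _ _
    _ < ε := by linarith [hδ.2]

namespace SAW

variable {P P' : ChordalFamily}

/-! ### Every Dobrushin domain admits an endpoint approximation -/

/-- **Endpoint approximations exist** for every Dobrushin domain `D = (Ω; a, b)`: there are
lattice endpoints `a_δ, b_δ`, joined in `Ω_δ` for all small `δ > 0`, whose mesh points converge
to `a` and `b`. Construction: interior points `z_n → a`, `w_n → b` with closed discs about them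
inside `Ω`; by `JordanDomain.exists_forall_mem_meshDomain_and_reachable` (the largest mesh
component of a Jordan domain is the bulk), for `δ` below a stage threshold the lattice sites
nearest to `z_n`, `w_n` lie in `Ω_δ` and are joined there; a diagonal stage selection
`n = N(δ) → ∞` (`exists_stage_tendsto_atTop`) finishes. In particular the hypothesis
`∀ a b, IsEndpointApprox D a b → …` of `SAWScalingLimit` / `IsScalingLimitFamily` is never
vacuous. (Duminil-Copin–Smirnov take "`a_δ`, `b_δ` the vertices of `Ω_δ` closest to `a`, `b`".) [folklore] -/
theorem exists_isEndpointApprox (D : DobrushinDomain) :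
    ∃ a b : ℝ → Site 2, IsEndpointApprox D a b := by
  classical
  -- interior points `z i n → D.pt i` with closed discs of radius `r i n` inside `Ω`
  have hz : ∀ (i : Fin 2) (n : ℕ), ∃ z ∈ D.carrier, dist z (D.pt i) < 1 / ((n : ℝ) + 1) ∧
      ∃ r > 0, closedBall z r ⊆ D.carrier := by
    intro i n
    obtain ⟨z, hz, hd⟩ := Metric.mem_closure_iff.1
      (frontier_subset_closure (D.pt_mem_frontier i)) (1 / ((n : ℝ) + 1)) (by positivity)
    obtain ⟨r, hr, hsub⟩ := Metric.isOpen_iff.1 D.isOpen z hz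
    exact ⟨z, hz, by rwa [dist_comm], r / 2, by positivity,
      (closedBall_subset_ball (by linarith)).trans hsub⟩
  choose z hzΩ hzd r hr hrΩ using hz
  -- stage `n`: both closed discs, a compact subset of `Ω`
  set K : ℕ → Set ℂ := fun n => closedBall (z 0 n) (r 0 n) ∪ closedBall (z 1 n) (r 1 n)
    with hK_def
  have hKc : ∀ n, IsCompact (K n) := fun n =>
    (isCompact_closedBall _ _).union (isCompact_closedBall _ _)
  have hKΩ : ∀ n, K n ⊆ D.carrier := fun n => union_subset (hrΩ 0 n) (hrΩ 1 n)
  have hstage := fun n =>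
    D.toJordanDomain.exists_forall_mem_meshDomain_and_reachable (hKc n) (hKΩ n)
  choose δ₀ hδ₀ hgood using hstage
  -- diagonal stage selection
  obtain ⟨N, hN, hNtop⟩ := exists_stage_tendsto_atTop
    (p := fun n δ => 0 < δ ∧ δ < min (δ₀ n) (min (r 0 n) (r 1 n)))
    (ε := fun n => min (δ₀ n) (min (r 0 n) (r 1 n)))
    (fun n => lt_min (hδ₀ n) (lt_min (hr 0 n) (hr 1 n))) (fun n δ h₁ h₂ => ⟨h₁, h₂⟩)
  refine ⟨fun δ => nearestSite δ (z 0 (N δ)), fun δ => nearestSite δ (z 1 (N δ)), ?_,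
    tendsto_meshPoint_nearestSite_of_tendsto (hzd 0) hNtop,
    tendsto_meshPoint_nearestSite_of_tendsto (hzd 1) hNtop⟩
  filter_upwards [hN] with δ ⟨hδ, hlt⟩
  have hδ₀' : δ < δ₀ (N δ) := hlt.trans_le (min_le_left _ _)
  have hr0 : δ < r 0 (N δ) := hlt.trans_le ((min_le_right _ _).trans (min_le_left _ _))
  have hr1 : δ < r 1 (N δ) := hlt.trans_le ((min_le_right _ _).trans (min_le_right _ _))
  have hmem : ∀ i : Fin 2, δ < r i (N δ) →
      meshPoint δ (nearestSite δ (z i (N δ))) ∈ closedBall (z i (N δ)) (r i (N δ)) :=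
    fun i hri => mem_closedBall.2 ((dist_meshPoint_nearestSite_le hδ _).trans hri.le)
  obtain ⟨hin, hconn⟩ := hgood (N δ) δ hδ hδ₀'
  have ha := hin _ (Or.inl (hmem 0 hr0))
  have hb := hin _ (Or.inr (hmem 1 hr1))
  obtain ⟨_, _, ⟨q⟩⟩ := hconn _ ha _ hb
  exact reachable_discreteDomainGraph_of_walk q ha

/-- Endpoint approximations only see `(carrier, pt 0, pt 1)` of the Dobrushin domain (not its
boundary parametrisation). [folklore] -/
theorem IsEndpointApprox.congr {D D' : DobrushinDomain} {a b : ℝ → Site 2}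
    (h : IsEndpointApprox D a b) (hc : D.carrier = D'.carrier) (h0 : D.pt 0 = D'.pt 0)
    (h1 : D.pt 1 = D'.pt 1) : IsEndpointApprox D' a b := by
  refine ⟨?_, h0 ▸ h.tendsto_fst, h1 ▸ h.tendsto_snd⟩
  rw [← hc]
  exact h.reachable

/-! ### Uniqueness: the scaling limit, if it exists, is determined by the lattice model -/

/-- **The law `P D` of a scaling-limit family is determined by `(D.carrier, D.pt 0, D.pt 1)`,
across families**: if `P`, `P'` are scaling-limit families and `D`, `D'` have the same carrier
and the same marked points, then `P D = P' D'`. Both are weak limits, along the proper filter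
`δ → 0⁺`, of the same critical SAW laws (an endpoint approximation exists,
`exists_isEndpointApprox`), and weak limits of probability measures are unique
(`TendstoLaw.unique`). [folklore] -/
theorem IsScalingLimitFamily.apply_eq (hP : IsScalingLimitFamily P) (hP' : IsScalingLimitFamily P')
    {D D' : DobrushinDomain} (hc : D.carrier = D'.carrier) (h0 : D.pt 0 = D'.pt 0)
    (h1 : D.pt 1 = D'.pt 1) : P D = P' D' := by
  obtain ⟨a, b, hab⟩ := exists_isEndpointApprox D
  haveI := hP.isProbabilityMeasure D
  haveI := hP'.isProbabilityMeasure D'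
  have h₁ := hP.tendstoLaw hab
  have h₂ := hP'.tendstoLaw (hab.congr hc h0 h1)
  rw [← hc] at h₂
  exact h₁.unique h₂

/-- **Uniqueness of the scaling limit**: two scaling-limit families of the critical SAW
coincide. [folklore] -/
theorem IsScalingLimitFamily.unique (hP : IsScalingLimitFamily P) (hP' : IsScalingLimitFamily P') :
    P = P' :=
  funext fun _ => hP.apply_eq hP' rfl rfl rfl

/-- `P D` depends on the Dobrushin domain only through `(carrier, pt 0, pt 1)`. [folklore] -/
theorem IsScalingLimitFamily.apply_eq_of_carrier_eq (hP : IsScalingLimitFamily P)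
    {D D' : DobrushinDomain} (hc : D.carrier = D'.carrier) (h0 : D.pt 0 = D'.pt 0)
    (h1 : D.pt 1 = D'.pt 1) : P D = P D' :=
  hP.apply_eq hP hc h0 h1

/-! ### Reformulation of the conjunct `SAWScalingLimit` -/

/-- **A scaling-limit family of SLE_{8/3} laws gives `SAWScalingLimit`.** If `P` is a scaling
limit family and every `P D` is the chordal SLE_{8/3} law in `D`, then the critical SAW converges
to chordal SLE_{8/3} (`ConvergesInLawToSLE`): write `P D = W.map Γ` for an SLE curve `Γ` and move
the test integrals along `integral_map`; measurability of `γ ↦ γ.curve` is `aemeasurable_curve`.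
This is the last step of the assemblies of routes SAWConfRestriction / SAWRestrictionRigidity.
[cite: LawlerSchrammWerner2004SAW, §4.1] -/
theorem IsScalingLimitFamily.sawScalingLimit (hP : IsScalingLimitFamily P)
    (hSLE : ∀ D : DobrushinDomain, IsSLELaw ((8 : ℝ≥0) / 3) D (P D)) : SAWScalingLimit := by
  intro D a b hab
  obtain ⟨Γ, hΓ, hPD⟩ := hSLE D
  refine ⟨Γ, hΓ, Eventually.of_forall fun δ => aemeasurable_curve _ _ _ _, fun f => ?_⟩
  have h := hP.tendstoLaw hab f
  simp only [id_eq, hPD] at h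
  rwa [integral_map hΓ.aemeasurable f.continuous.aestronglyMeasurable] at h

/-- **Under `SAWScalingLimit`, every chordal family of SLE_{8/3} laws is a scaling-limit
family** (given uniqueness in law of chordal SLE, the named fact `IsSLECurve.map_eq`, discharged
in `SLEUniquenessInLaw.lean`): for each `(D, a_δ, b_δ)` the conjunct provides SOME SLE_{8/3}
curve `Γ` with `X_δ → Γ` in law, and `W.map Γ = P D` by uniqueness. [folklore] -/
theorem isScalingLimitFamily_of_sawScalingLimit (huniq : IsSLECurve.map_eq) (h : SAWScalingLimit)
    (hP : P.IsChordal) (hSLE : ∀ D : DobrushinDomain, IsSLELaw ((8 : ℝ≥0) / 3) D (P D)) :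
    IsScalingLimitFamily P := by
  refine ⟨hP, fun D a b hab f => ?_⟩
  obtain ⟨Γ, hΓ, -, hT⟩ := h D a b hab
  obtain ⟨Γ', hΓ', hPD⟩ := hSLE D
  have hlaw : P D = Process.preWienerMeasure.map Γ := hPD.trans (huniq hΓ' hΓ)
  simp only [id_eq, hlaw]
  rw [integral_map hΓ.aemeasurable f.continuous.aestronglyMeasurable]
  exact hT f

/-- **`SAWScalingLimit ↔ ∃` a scaling-limit family of SLE_{8/3} laws**, as soon as ONE chordal
family `Q` of SLE_{8/3} laws is at hand (e.g. the tree's `sleEightThirdsFamily`, chordal by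
`sleEightThirdsFamily_spec`) and chordal SLE is unique in law (`IsSLECurve.map_eq`). [folklore] -/
theorem sawScalingLimit_iff_of_chordal_sle (huniq : IsSLECurve.map_eq) {Q : ChordalFamily}
    (hQ : Q.IsChordal) (hQsle : ∀ D : DobrushinDomain, IsSLELaw ((8 : ℝ≥0) / 3) D (Q D)) :
    SAWScalingLimit ↔
      ∃ P : ChordalFamily, IsScalingLimitFamily P ∧
        ∀ D : DobrushinDomain, IsSLELaw ((8 : ℝ≥0) / 3) D (P D) :=
  ⟨fun h => ⟨Q, isScalingLimitFamily_of_sawScalingLimit huniq h hQ hQsle, hQsle⟩,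
    fun ⟨_, hP, hsle⟩ => hP.sawScalingLimit hsle⟩

/-- **Under `SAWScalingLimit` the scaling-limit family IS the SLE_{8/3} family**: if `P` is a
scaling-limit family, the conjunct holds, chordal SLE is unique in law and some chordal family
`Q` of SLE_{8/3} laws exists, then every `P D` is the chordal SLE_{8/3} law in `D` (`P = Q` by
`IsScalingLimitFamily.unique`). [folklore] -/
theorem IsScalingLimitFamily.isSLELaw_of_sawScalingLimit (hP : IsScalingLimitFamily P)
    (huniq : IsSLECurve.map_eq) (h : SAWScalingLimit) {Q : ChordalFamily} (hQ : Q.IsChordal)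
    (hQsle : ∀ D : DobrushinDomain, IsSLELaw ((8 : ℝ≥0) / 3) D (Q D)) (D : DobrushinDomain) :
    IsSLELaw ((8 : ℝ≥0) / 3) D (P D) := by
  rw [hP.unique (isScalingLimitFamily_of_sawScalingLimit huniq h hQ hQsle)]
  exact hQsle D

end SAW

end Literature.Probability.RandomPlanarGeometry
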